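import Literature.MathematicalPhysics.QuantumFieldTheory.Balaban1983to89.B8Thm4SupportLocal
import Literature.MathematicalPhysics.QuantumFieldTheory.Balaban1983to89.B8Prop3GaugeFixedKLevelBdry
import Literature.MathematicalPhysics.QuantumFieldTheory.Balaban1983to89.B8Eq142KLevelLocal

/-!
# `Balaban1983to89.B8Thm4SupportLocalBdry` — [Balaban1985RegularSpaces] THEOREM 4 (p. 88), EXISTENCE CLAUSE AT ALL LEVELS ON THE `ℤᵈ`
# CARRIERS, GAUGE TRANSFORMATIONS CARRIED BY `Ω₀` — the (1.59) in-edge in the REPAIRED currency `H59D` (exterior-collar term, R-d)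

statement-level skeleton of published theorems with citation tags; proofs where landed; nothing here is a claim about the
Yang–Mills mass gap

PDF held: `paper:balaban1985-cmp99-regular-spaces-gauge-fixing` (journal page = PDF page + 74); pp. 82–83, 86–89, 94–95.

CITATION HEADER (lean-in-tree rule).  Cell `pub-ymgap` (YM Track A, HUMAN RULING D-0062), DAG node N05 = [B8], seat `pub-ymgap-dag-n05-e`
(R141 (C) fan-out), generation g6 — third brick of the located repair R-d (`B8Prop3KLevelBdry`, `B8Prop3GaugeFixedKLevelBdry`).  WHY: the
support driver `B8Thm4SupportLocal.thm4_exists_all_levels_supp` (n04-b) types its Proposition-3 socket `hP3` without the support clause of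
the gauge transformation, and its composition `…_landau138` feeds `hP3` from the (1.59) in-edge `H59` — false at finite `Ω₀`.  The repaired
in-edge `H59D` reads the exterior collar of `Ω₀`, where only the datum is visible IF `u = 1` there; so the socket must be allowed to assume
the support clause — which the driver has at its single call site.  THIS FILE: `thm4_exists_all_levels_supp_bdry` (the driver with that
binder; proof verbatim) and `thm4_exists_all_levels_supp_landau138_bdry` (the composition with `hP3_gaugeFixed_of_b9_bdry`, `H59 ↦ H59D`).
Kind «kernel-checked proof», theorems only, no `def`.

HONEST SCOPE.  By-name re-threading of landed theorems; `H59D`, the Prop.-5 sockets and the standing hypotheses remain HYPOTHESES; the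
window `4B_∂a ≤ (dL − 1)B₀(α₀ + α₁)` is the tree's (print has no `B_∂`).  Count-neutral; N05 NOT discharged; one finite `𝕋⁴` programme at
fixed `ε`, Bałaban as printed; nothing continuum ∕ ℝ⁴ ∕ OS ∕ mass-gap ∕ Clay.  Unit `pub-ymgap-dag-n05-e` (g6), 2026-08-27.
-/

noncomputable section

open NormedSpace

namespace Literature.MathematicalPhysics.QuantumFieldTheory.Balaban1983to89.B8Thm4SupportLocalBdry

open Complex (I)
open MatrixLog B7Prop1Explicit B7Prop2Explicit B7Prop1Local B7Eq92Concrete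
open B8Ineq132 (covDerivFwd InAk BondTouches)
open B8Eq119TwistedAxial (Restr129 InAx)
open B8Eq184Proof (gaugeExp cfgExp)
open B8Thm4TruncationLocal (base_datum restr129_one)
open B8Prop3GaugeFixedKLevel (mem_unitaryUnits_of_mgauge_eq)
open B8Prop3GaugeFixedKLevelBdry (hP3_gaugeFixed_of_b9_bdry)
open B8Thm4SupportLocal (thm4_exists_step_onBonds_supp)
open B8Lemma1NonAbelian (mulCfg)
open B8Eq140Level (SideTouches)
open B8Eq146AExpansion (iEta)
open B7Prop4GeneralLevels (logCovIter linCovIter)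
open B8Eq155JBound (Jcur wsup)
open B8ScaledSupNorm (bondNorm msup)
open B7Prop3Flat (c3)
open B8Thm2LogB (blockTop)
open B8Ineq130 (tlo thi)
open B8Eq138LandauZd (IsLandau138W)

-- `Site` alone could resolve to the torus sites of `Setup.lean`; re-export the `ℤ^d` sites of `B7Prop1Explicit`.
export B7Prop1Explicit (Site)

variable {d : ℕ}

section Main

variable {𝔸 : Type*} [CStarAlgebra 𝔸] [Nontrivial 𝔸]
variable {L k : ℕ} {η : ℝ} {U₀ U' : Site d → Fin d → 𝔸ˣ} {a cstar α₄ : ℝ}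

/-- One level up costs a factor `L`: `c⋆(Lʲη)⁻¹ = (Lc⋆)(L^{j+1}η)⁻¹` and `c⋆(Lʲη)⁻¹ ≤ (Lc⋆)(Lʲη)⁻¹` (`L ≥ 1`, `c⋆ ≥ 0`) — the bookkeeping of
(1.111) (`B8Eq1110Concrete.ineq1111_of_1110`). [cite: Balaban1985RegularSpaces, (1.111) p.95] -/
private theorem level_shift (hL1 : 1 ≤ L) (hη : 0 < η) (hc : 0 ≤ cstar) (j : ℕ) :
    cstar * ((L : ℝ) ^ j * η)⁻¹ = L * cstar * ((L : ℝ) ^ (j + 1) * η)⁻¹ ∧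
      cstar * ((L : ℝ) ^ j * η)⁻¹ ≤ L * cstar * ((L : ℝ) ^ j * η)⁻¹ := by
  have hLr : (1 : ℝ) ≤ L := by exact_mod_cast hL1
  have hL0 : (0 : ℝ) < L := by linarith
  have ht : 0 ≤ ((L : ℝ) ^ j * η)⁻¹ := by positivity
  refine ⟨?_, ?_⟩
  · rw [pow_succ]
    field_simp
  · calc cstar * ((L : ℝ) ^ j * η)⁻¹ = 1 * cstar * ((L : ℝ) ^ j * η)⁻¹ := by ring
      _ ≤ L * cstar * ((L : ℝ) ^ j * η)⁻¹ := by gcongr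

/-- **THE INDUCTION DRIVER WITH THE SUPPORT INVARIANT, THE PROPOSITION-3 SOCKET READING THE SUPPORT** — n04-b's
`B8Thm4SupportLocal.thm4_exists_all_levels_supp` VERBATIM except that the socket `hP3` may assume «`u = 1` off `S`» for the triple it
resets (its one call site has the invariant in scope).  This is the shape the repaired (1.59) currency needs: the exterior-collar term
of a finite `Ω₀` is read off the datum only where the gauge transformation is trivial.
[cite: Balaban1985RegularSpaces, Thm 4 p.88, proof pp.88–89 + 94–95, Prop. 5 (1.107)–(1.108) p.94, Prop. 3 p.87, (1.17) p.78] -/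
theorem thm4_exists_all_levels_supp_bdry (hL1 : 1 ≤ L) (hη : 0 < η) (S : Set (Site d))
    (hU₀ : ∀ x κ, U₀ x κ ∈ unitaryUnits 𝔸) (hU' : ∀ x κ, U' x κ ∈ unitaryUnits 𝔸)
    (hcstar : 0 ≤ cstar) (hα₄ : 0 ≤ α₄) (hs₁ : α₄ ≤ 1 / 84) (hs₂ : L * cstar ≤ 1 / 12) (ha : a ≤ 1 / 4) (ha2 : 2 * a ≤ cstar)
    (E : ℕ → Set (Site d × Fin d)) (hE : ∀ j, E (j + 1) ⊆ E j)
    (h66 : ∀ b ∈ E 0, ‖((U' b.1 b.2 : 𝔸ˣ) : 𝔸) - 1‖ ≤ a)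
    (Λs : ℕ → ℕ → Set (Site d)) (Lan : ℕ → (Site d → Fin d → 𝔸ˣ) → Prop)
    (hP5base : ∃ (v : Site d → 𝔸ˣ) (lam : Site d → 𝔸), (∀ x, v x ∈ unitaryUnits 𝔸) ∧ (∀ x, x ∉ S → v x = 1) ∧
        (∀ j, j ≤ 1 → ∀ b ∈ E j, (v b.1 : 𝔸) = ((gaugeExp lam b.1 : 𝔸ˣ) : 𝔸) ∧
          (v (b.1 + e b.2) : 𝔸) = ((gaugeExp lam (b.1 + e b.2) : 𝔸ˣ) : 𝔸)) ∧
        (∀ j, j ≤ 1 → ∀ b ∈ E j, ‖lam b.1‖ ≤ α₄ ∧ ((L : ℝ) ^ j * η) * ‖covDerivFwd η U₀ b.2 lam b.1‖ ≤ α₄) ∧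
        Lan 1 (mgauge U₀ v⁻¹ U') ∧ Restr129 L 1 (Λs 1) U₀ ((1 : Site d → 𝔸ˣ) * v))
    (hP5 : ∀ m, 1 ≤ m → m < k → ∀ (u₁ : Site d → 𝔸ˣ) (U₁ : Site d → Fin d → 𝔸ˣ) (A : Site d → Fin d → 𝔸),
      (∀ x, u₁ x ∈ unitaryUnits 𝔸) → (∀ x, x ∉ S → u₁ x = 1) → mgauge U₀ u₁ U₁ = U' → Restr129 L m (Λs m) U₀ u₁ → Lan m U₁ →
      (∀ j, j ≤ m → ∀ b ∈ E j, U₁ b.1 b.2 = cfgExp η A b.1 b.2 ∧ IsSelfAdjoint (A b.1 b.2) ∧ ‖A b.1 b.2‖ ≤ cstar * ((L : ℝ) ^ j * η)⁻¹) →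
      ∃ (v : Site d → 𝔸ˣ) (lam : Site d → 𝔸), (∀ x, v x ∈ unitaryUnits 𝔸) ∧ (∀ x, x ∉ S → v x = 1) ∧
        (∀ j, j ≤ m + 1 → ∀ b ∈ E j, (v b.1 : 𝔸) = ((gaugeExp lam b.1 : 𝔸ˣ) : 𝔸) ∧
          (v (b.1 + e b.2) : 𝔸) = ((gaugeExp lam (b.1 + e b.2) : 𝔸ˣ) : 𝔸)) ∧
        (∀ j, j ≤ m + 1 → ∀ b ∈ E j, ‖lam b.1‖ ≤ α₄ ∧ ((L : ℝ) ^ j * η) * ‖covDerivFwd η U₀ b.2 lam b.1‖ ≤ α₄) ∧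
        Lan (m + 1) (mgauge U₀ v⁻¹ U₁) ∧ Restr129 L (m + 1) (Λs (m + 1)) U₀ (u₁ * v))
    (hP3 : ∀ m, 1 ≤ m → m ≤ k → ∀ (u : Site d → 𝔸ˣ) (W : Site d → Fin d → 𝔸ˣ) (A : Site d → Fin d → 𝔸),
      (∀ x, u x ∈ unitaryUnits 𝔸) → (∀ x, x ∉ S → u x = 1) → mgauge U₀ u W = U' → Restr129 L m (Λs m) U₀ u → Lan m W →
      (∀ j, j ≤ m → ∀ b ∈ E j, W b.1 b.2 = cfgExp η A b.1 b.2 ∧ ‖A b.1 b.2‖ ≤ (2 * (L * cstar) + 8 * α₄) * ((L : ℝ) ^ j * η)⁻¹) →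
      ∀ j, j ≤ m → ∀ b ∈ E j, ‖A b.1 b.2‖ ≤ cstar * ((L : ℝ) ^ j * η)⁻¹) :
    ∀ m, m ≤ k → ∃ u : Site d → 𝔸ˣ, (∀ x, u x ∈ unitaryUnits 𝔸) ∧ (∀ x, x ∉ S → u x = 1) ∧ Restr129 L m (Λs m) U₀ u ∧
      ∃ W : Site d → Fin d → 𝔸ˣ, mgauge U₀ u W = U' ∧ (1 ≤ m → Lan m W) ∧
        ∃ A : Site d → Fin d → 𝔸, ∀ j, j ≤ m → ∀ b ∈ E j,
          W b.1 b.2 = cfgExp η A b.1 b.2 ∧ IsSelfAdjoint (A b.1 b.2) ∧ ‖A b.1 b.2‖ ≤ cstar * ((L : ℝ) ^ j * η)⁻¹ := by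
  have hLc : 0 ≤ L * cstar := by positivity
  -- reading a `c⋆`-bound at levels `≤ m` as an `Lc⋆`-bound at levels `≤ m + 1` (`E` antitone)
  have hshift : ∀ (m : ℕ) (A : Site d → Fin d → 𝔸),
      (∀ j, j ≤ m → ∀ b ∈ E j, ‖A b.1 b.2‖ ≤ cstar * ((L : ℝ) ^ j * η)⁻¹) →
      ∀ j, j ≤ m + 1 → ∀ b ∈ E j, ‖A b.1 b.2‖ ≤ L * cstar * ((L : ℝ) ^ j * η)⁻¹ := by
    intro m A h j hj b hb
    rcases Nat.lt_or_ge j (m + 1) with hjm | hjm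
    · exact (h j (by omega) b hb).trans (level_shift hL1 hη hcstar j).2
    · obtain rfl : j = m + 1 := le_antisymm hj hjm
      have h' := h m le_rfl b (hE m hb)
      rw [(level_shift hL1 hη hcstar m).1] at h'
      exact h'
  -- THE COMMON TAIL OF A STEP: level-`m` datum + Proposition 5's data at level `m + 1` ⇒ the conclusion at level `m + 1`
  -- (`thm4_exists_step_onBonds` with `c := Lc⋆`, then the reset `hP3 (m + 1)`)
  have tail : ∀ m, m < k → ∀ (u₁ : Site d → 𝔸ˣ) (U₁ : Site d → Fin d → 𝔸ˣ) (A : Site d → Fin d → 𝔸),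
      (∀ x, u₁ x ∈ unitaryUnits 𝔸) → (∀ x, x ∉ S → u₁ x = 1) → mgauge U₀ u₁ U₁ = U' →
      (∀ j, j ≤ m → ∀ b ∈ E j, U₁ b.1 b.2 = cfgExp η A b.1 b.2 ∧ IsSelfAdjoint (A b.1 b.2) ∧
        ‖A b.1 b.2‖ ≤ cstar * ((L : ℝ) ^ j * η)⁻¹) →
      ∀ (v : Site d → 𝔸ˣ) (lam : Site d → 𝔸), (∀ x, v x ∈ unitaryUnits 𝔸) → (∀ x, x ∉ S → v x = 1) →
        (∀ j, j ≤ m + 1 → ∀ b ∈ E j, (v b.1 : 𝔸) = ((gaugeExp lam b.1 : 𝔸ˣ) : 𝔸) ∧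
          (v (b.1 + e b.2) : 𝔸) = ((gaugeExp lam (b.1 + e b.2) : 𝔸ˣ) : 𝔸)) →
        (∀ j, j ≤ m + 1 → ∀ b ∈ E j, ‖lam b.1‖ ≤ α₄ ∧ ((L : ℝ) ^ j * η) * ‖covDerivFwd η U₀ b.2 lam b.1‖ ≤ α₄) →
        Lan (m + 1) (mgauge U₀ v⁻¹ U₁) → Restr129 L (m + 1) (Λs (m + 1)) U₀ (u₁ * v) →
      ∃ u : Site d → 𝔸ˣ, (∀ x, u x ∈ unitaryUnits 𝔸) ∧ (∀ x, x ∉ S → u x = 1) ∧ Restr129 L (m + 1) (Λs (m + 1)) U₀ u ∧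
        ∃ W : Site d → Fin d → 𝔸ˣ, mgauge U₀ u W = U' ∧ (1 ≤ m + 1 → Lan (m + 1) W) ∧
          ∃ A' : Site d → Fin d → 𝔸, ∀ j, j ≤ m + 1 → ∀ b ∈ E j,
            W b.1 b.2 = cfgExp η A' b.1 b.2 ∧ IsSelfAdjoint (A' b.1 b.2) ∧ ‖A' b.1 b.2‖ ≤ cstar * ((L : ℝ) ^ j * η)⁻¹ := by
    intro m hmk u₁ U₁ A hu₁ hu₁S hU₁ hA v lam hv hvS hvlam h108 hLan h129
    -- `U₁ = e^{iηA}` and (1.69) with `c = Lc⋆` on `E j`, `j ≤ m + 1`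
    have hAexp : ∀ j, j ≤ m + 1 → ∀ b ∈ E j, U₁ b.1 b.2 = cfgExp η A b.1 b.2 := by
      intro j hj b hb
      rcases Nat.lt_or_ge j (m + 1) with hjm | hjm
      · exact (hA j (by omega) b hb).1
      · obtain rfl : j = m + 1 := le_antisymm hj hjm
        exact (hA m le_rfl b (hE m hb)).1
    have h69 := hshift m A (fun j hj b hb => (hA j hj b hb).2.2)
    obtain ⟨u, hu, huS, h29, W, hW, hLanW, A', hA'⟩ := thm4_exists_step_onBonds_supp (k := m + 1) (Λ := Λs (m + 1)) hL1 hη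
      hU₀ hU' hu₁ hv S hu₁S hvS hLc hα₄ hs₁ hs₂ hU₁ E hAexp h69 hvlam h108 (Lan (m + 1)) hLan h129
    -- Proposition 3 at level `m + 1`: reset the constant `2Lc⋆ + 8α₄ ↦ c⋆`
    have hreset := hP3 (m + 1) (by omega) (by omega) u W A' hu huS hW h29 hLanW
      (fun j hj b hb => ⟨(hA' j hj b hb).1, (hA' j hj b hb).2.2⟩)
    exact ⟨u, hu, huS, h29, W, hW, fun _ => hLanW, A', fun j hj b hb => ⟨(hA' j hj b hb).1, (hA' j hj b hb).2.1, hreset j hj b hb⟩⟩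
  -- THE BASE DATUM: `u = 1`, `W = U′`, `A₀ = (1/iη) log U′`
  have base : ∀ j, j ≤ 0 → ∀ b ∈ E j,
      U' b.1 b.2 = cfgExp η (fun y μ => η⁻¹ • ((I⁻¹ : ℂ) • mlog ((U' y μ : 𝔸ˣ) : 𝔸))) b.1 b.2 ∧
        IsSelfAdjoint ((fun y μ => η⁻¹ • ((I⁻¹ : ℂ) • mlog ((U' y μ : 𝔸ˣ) : 𝔸))) b.1 b.2) ∧
        ‖(fun y μ => η⁻¹ • ((I⁻¹ : ℂ) • mlog ((U' y μ : 𝔸ˣ) : 𝔸))) b.1 b.2‖ ≤ cstar * ((L : ℝ) ^ j * η)⁻¹ := by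
    intro j hj b hb
    obtain rfl : j = 0 := Nat.le_zero.mp hj
    obtain ⟨-, hexp, hsa, hbd⟩ := base_datum hη U₀ U' hU' ha b.1 b.2 (h66 b hb)
    refine ⟨hexp, hsa, hbd.trans ?_⟩
    rw [pow_zero, one_mul]
    exact mul_le_mul_of_nonneg_right ha2 (inv_nonneg.mpr hη.le)
  have hone : mgauge U₀ (1 : Site d → 𝔸ˣ) U' = U' := by
    funext z μ; simp [mgauge_apply]
  intro m
  induction m with
  | zero =>
    intro _
    exact ⟨1, fun x => (unitaryUnits 𝔸).one_mem, fun _ _ => rfl, restr129_one L 0 (Λs 0) U₀, U', hone, fun h => absurd h (by omega),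
      _, base⟩
  | succ m ih =>
    intro hmk
    rcases Nat.eq_zero_or_pos m with rfl | hm
    · -- the first step («k = 1»): Proposition 5 for the base datum
      obtain ⟨v, lam, hv, hvS, hvlam, h108, hLan, h129⟩ := hP5base
      exact tail 0 (by omega) 1 U' _ (fun x => (unitaryUnits 𝔸).one_mem) (fun _ _ => rfl) hone base v lam hv hvS hvlam h108 hLan h129
    · -- the general step: Proposition 5 for the datum delivered at level `m`
      obtain ⟨u₁, hu₁, hu₁S, h129₁, U₁, hU₁, hLan₁, A, hA⟩ := ih (by omega)
      obtain ⟨v, lam, hv, hvS, hvlam, h108, hLan, h129⟩ := hP5 m hm (by omega) u₁ U₁ A hu₁ hu₁S hU₁ h129₁ (hLan₁ hm) hA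
      exact tail m (by omega) u₁ U₁ A hu₁ hu₁S hU₁ hA v lam hv hvS hvlam h108 hLan h129


end Main

section Composition

variable {𝔸 : Type*} [CStarAlgebra 𝔸] [Nontrivial 𝔸]

variable {𝔸 : Type*} [CStarAlgebra 𝔸] [Nontrivial 𝔸]

/-- **THEOREM 4, EXISTENCE CLAUSE AT ALL LEVELS, GAUGE TRANSFORMATIONS CARRIED BY Ω₀, LANDAU EQUATION INSTANTIATED, (1.42) DISCHARGED —
THE (1.59) IN-EDGE IN THE REPAIRED CURRENCY `H59D`** (exterior-collar term, located repair R-d): n04-b's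
`thm4_exists_all_levels_supp_landau138` with `hP3` served by `B8Prop3GaugeFixedKLevelBdry.hP3_gaugeFixed_of_b9_bdry`; extra data `0 ≤ B_∂`,
`0 ≤ a` and the window `4B_∂a ≤ (dL − 1)B₀(α₀ + α₁)`; everything else — sockets `hP5base`∕`hP5`, (1.33)∕(1.34)∕axial∕(1.35)∕(1.66)₀,
geometry, windows, CONCLUSION — byte-identical. [cite: Balaban1985RegularSpaces, Thm 4 p.88, (1.38) p.82, (1.42) p.83, (1.59) p.86, Prop. 3 p.87, Prop. 5 p.94, pp.94–95] -/
theorem thm4_exists_all_levels_supp_landau138_bdry (hd2 : 2 ≤ d) {η : ℝ} (hη : 0 < η) {L : ℕ} (hL : 2 ≤ L) (k : ℕ)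
    {U₀ U' : Site d → Fin d → 𝔸ˣ} (hU₀ : ∀ x κ, U₀ x κ ∈ unitaryUnits 𝔸) (hU' : ∀ x κ, U' x κ ∈ unitaryUnits 𝔸)
    {α₀ α₁ α₄ B₀ cstar a : ℝ} (hα₀ : 0 < α₀) (hα₁ : 0 < α₁) (hα₄ : 0 ≤ α₄) (hB₀ : 0 ≤ B₀)
    (hc : cstar = 5 * d * L * B₀ * (α₀ + α₁))
    (hs₁ : α₄ ≤ 1 / 84) (hs₂ : L * cstar ≤ 1 / 12) (ha : a ≤ 1 / 4) (ha2 : 2 * a ≤ cstar)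
    (hα3 : C0 d * α₀ ≤ 1 / 3) (hα4 : 4 * α₀ ≤ c2' d L)
    (h16 : 16 * (2 * (L * cstar) + 8 * α₄) ≤ 1) (hd5 : 5 * (2 * (L * cstar) + 8 * α₄) * ((d : ℝ) - 1) ≤ 4)
    (hsmall : Real.exp (4 * (800 * ((d : ℝ) + 1) ^ 2 * ((d : ℝ) + 4)) * α₀)
      * (1 + 8 * (131072 * ((d : ℝ) + 1) ^ 2) * (2 * (L * cstar) + 8 * α₄)) ≤ 2)
    (hc₃ : 2 * (2 * (L * cstar) + 8 * α₄) ≤ c3 d L) (hside : 36 * d * B₀ * (2 * (L * cstar) + 8 * α₄) ≤ 1 / 2)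
    (h50 : 50 * d * (2 * (L * cstar) + 8 * α₄) ≤ 1) (hsmall₁ : (d : ℝ) * L * α₁ ≤ 1 / 8)
    {Bbd : ℝ} (hBbd : 0 ≤ Bbd) (ha0 : 0 ≤ a) (hbdry : 4 * Bbd * a ≤ ((d : ℝ) * L - 1) * B₀ * (α₀ + α₁))
    {C₂ : ℝ} (hC₂ : 8 * (131072 * ((d : ℝ) + 1) ^ 2) * Real.exp (4 * (800 * ((d : ℝ) + 1) ^ 2 * ((d : ℝ) + 4)) * α₀) ≤ C₂)
    (h61 : 2 * (2 * (L * cstar) + 8 * α₄) ^ 2 + 20 * d * α₀ * (2 * (L * cstar) + 8 * α₄)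
      + 2 * C₂ * (2 * (L * cstar) + 8 * α₄) ^ 2 ≤ α₀ + α₁)
    (Ω : ℕ → Set (Site d)) (hΩ : ∀ j, Ω (j + 1) ⊆ Ω j) (Λs : ℕ → ℕ → Set (Site d)) (Λb : ℕ → ℕ → Set (Site d × Fin d))
    (hbox : ∀ m, m ≤ k → ∀ j, j ≤ m → ∀ c ∈ Λb m j, ∀ x, InBox (loK L j c.1) (bondHiK L j c.1 c.2) x → x ∈ Ω j)
    (hclass : ∀ m, m ≤ k → ∀ j, j ≤ m → ∀ c ∈ Λb m j,
      (c.1 ∈ Λs m j ∧ c.1 + e c.2 ∈ Λs m j) ∨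
      (∃ j', j = j' + 1 ∧ (∀ x, (L : ℤ) • c.1 ≤ x → x ≤ (L : ℤ) • c.1 + blockTop L → x ∈ Λs m j') ∧ c.1 + e c.2 ∈ Λs m j) ∨
      (∃ j', j = j' + 1 ∧ c.1 ∈ Λs m j ∧ (∀ x, (L : ℤ) • (c.1 + e c.2) ≤ x → x ≤ (L : ℤ) • (c.1 + e c.2) + blockTop L → x ∈ Λs m j')))
    (h33 : InAk L k η α₀ Ω U₀) (h34 : InAk L k η α₀ Ω (mulCfg U' U₀))
    (hAx : ∀ m, m ≤ k → InAx L m (Λs m) U₀ (mulCfg U' U₀))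
    (h135 : ∀ j, j ≤ k → ∀ (z : Site d) (μ : Fin d), (∀ x, InBox (loK L j z) (bondHiK L j z μ) x → x ∈ Ω j) →
      ‖(avgIter L (mulCfg U' U₀) j z μ : 𝔸) - (avgIter L U₀ j z μ : 𝔸)‖ ≤ α₁)
    (h66 : ∀ b ∈ {b : Site d × Fin d | SideTouches (Ω 0) b.1 b.2}, ‖((U' b.1 b.2 : 𝔸ˣ) : 𝔸) - 1‖ ≤ a)
    (hP5base : ∃ (v : Site d → 𝔸ˣ) (lam : Site d → 𝔸), (∀ x, v x ∈ unitaryUnits 𝔸) ∧ (∀ x, x ∉ Ω 0 → v x = 1) ∧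
        (∀ j, j ≤ 1 → ∀ b ∈ {b : Site d × Fin d | SideTouches (Ω j) b.1 b.2}, (v b.1 : 𝔸) = ((gaugeExp lam b.1 : 𝔸ˣ) : 𝔸) ∧
          (v (b.1 + e b.2) : 𝔸) = ((gaugeExp lam (b.1 + e b.2) : 𝔸ˣ) : 𝔸)) ∧
        (∀ j, j ≤ 1 → ∀ b ∈ {b : Site d × Fin d | SideTouches (Ω j) b.1 b.2},
          ‖lam b.1‖ ≤ α₄ ∧ ((L : ℝ) ^ j * η) * ‖covDerivFwd η U₀ b.2 lam b.1‖ ≤ α₄) ∧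
        IsLandau138W L 1 η (Ω 0) (Λs 1) U₀ (mgauge U₀ v⁻¹ U') ∧ Restr129 L 1 (Λs 1) U₀ ((1 : Site d → 𝔸ˣ) * v))
    (hP5 : ∀ m, 1 ≤ m → m < k → ∀ (u₁ : Site d → 𝔸ˣ) (U₁ : Site d → Fin d → 𝔸ˣ) (A : Site d → Fin d → 𝔸),
      (∀ x, u₁ x ∈ unitaryUnits 𝔸) → (∀ x, x ∉ Ω 0 → u₁ x = 1) → mgauge U₀ u₁ U₁ = U' → Restr129 L m (Λs m) U₀ u₁ →
      IsLandau138W L m η (Ω 0) (Λs m) U₀ U₁ →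
      (∀ j, j ≤ m → ∀ b ∈ {b : Site d × Fin d | SideTouches (Ω j) b.1 b.2},
        U₁ b.1 b.2 = cfgExp η A b.1 b.2 ∧ IsSelfAdjoint (A b.1 b.2) ∧ ‖A b.1 b.2‖ ≤ cstar * ((L : ℝ) ^ j * η)⁻¹) →
      ∃ (v : Site d → 𝔸ˣ) (lam : Site d → 𝔸), (∀ x, v x ∈ unitaryUnits 𝔸) ∧ (∀ x, x ∉ Ω 0 → v x = 1) ∧
        (∀ j, j ≤ m + 1 → ∀ b ∈ {b : Site d × Fin d | SideTouches (Ω j) b.1 b.2}, (v b.1 : 𝔸) = ((gaugeExp lam b.1 : 𝔸ˣ) : 𝔸) ∧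
          (v (b.1 + e b.2) : 𝔸) = ((gaugeExp lam (b.1 + e b.2) : 𝔸ˣ) : 𝔸)) ∧
        (∀ j, j ≤ m + 1 → ∀ b ∈ {b : Site d × Fin d | SideTouches (Ω j) b.1 b.2},
          ‖lam b.1‖ ≤ α₄ ∧ ((L : ℝ) ^ j * η) * ‖covDerivFwd η U₀ b.2 lam b.1‖ ≤ α₄) ∧
        IsLandau138W L (m + 1) η (Ω 0) (Λs (m + 1)) U₀ (mgauge U₀ v⁻¹ U₁) ∧ Restr129 L (m + 1) (Λs (m + 1)) U₀ (u₁ * v))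
    (H59D : ∀ m, 1 ≤ m → m ≤ k → ∀ (u : Site d → 𝔸ˣ) (W : Site d → Fin d → 𝔸ˣ) (A' : Site d → Fin d → 𝔸),
      (∀ x, u x ∈ unitaryUnits 𝔸) → (∀ x, x ∉ Ω 0 → u x = 1) → mgauge U₀ u W = U' → Restr129 L m (Λs m) U₀ u →
      IsLandau138W L m η (Ω 0) (Λs m) U₀ W →
      (∀ y τ, IsSelfAdjoint (A' y τ)) →
      (∀ j, j ≤ m → ∀ y τ, SideTouches (Ω j) y τ →
        W y τ = cfgExp η A' y τ ∧ ‖A' y τ‖ ≤ (2 * (L * cstar) + 8 * α₄) * ((L : ℝ) ^ j * η)⁻¹) →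
      (∀ y τ, (∀ j, j ≤ m → ¬ SideTouches (Ω j) y τ) → A' y τ = 0) →
      msup L m η (-(1 : ℝ)) (fun j (b : Site d × Fin d) => SideTouches (Ω j) b.1 b.2) (fun b => A' b.1 b.2)
          ≤ B₀ * (bondNorm L m η (-(3 : ℝ)) Ω (fun x μ => Jcur η U₀ A' μ x)
            + wsup 1 (fun p : {p : ℕ × (Site d × Fin d) // p.1 ≤ m ∧ p.2 ∈ Λb m p.1} =>
                linCovIter L U₀ (iEta η A') p.1.1 p.1.2.1 p.1.2.2))
            + Bbd * msup L m η (-(1 : ℝ)) (fun j (b : Site d × Fin d) => j = 0 ∧ SideTouches (Ω 0) b.1 b.2 ∧ ¬ BondTouches (Ω 0) b.1 b.2)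
                (fun b => A' b.1 b.2) ∧
        msup L m η (-(2 : ℝ)) (fun j (t : Fin d × Fin d × Site d) => SideTouches (Ω j) t.2.2 t.2.1)
            (fun t => covDerivFwd η U₀ t.1 (fun z => A' z t.2.1) t.2.2)
          ≤ B₀ * (bondNorm L m η (-(3 : ℝ)) Ω (fun x μ => Jcur η U₀ A' μ x)
            + wsup 1 (fun p : {p : ℕ × (Site d × Fin d) // p.1 ≤ m ∧ p.2 ∈ Λb m p.1} =>
                linCovIter L U₀ (iEta η A') p.1.1 p.1.2.1 p.1.2.2))
            + Bbd * msup L m η (-(1 : ℝ)) (fun j (b : Site d × Fin d) => j = 0 ∧ SideTouches (Ω 0) b.1 b.2 ∧ ¬ BondTouches (Ω 0) b.1 b.2)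
                (fun b => A' b.1 b.2)) :
    ∀ m, m ≤ k → ∃ u : Site d → 𝔸ˣ, (∀ x, u x ∈ unitaryUnits 𝔸) ∧ (∀ x, x ∉ Ω 0 → u x = 1) ∧ Restr129 L m (Λs m) U₀ u ∧
      ∃ W : Site d → Fin d → 𝔸ˣ, mgauge U₀ u W = U' ∧ (1 ≤ m → IsLandau138W L m η (Ω 0) (Λs m) U₀ W) ∧
        ∃ A : Site d → Fin d → 𝔸, ∀ j, j ≤ m → ∀ b ∈ {b : Site d × Fin d | SideTouches (Ω j) b.1 b.2},
          W b.1 b.2 = cfgExp η A b.1 b.2 ∧ IsSelfAdjoint (A b.1 b.2) ∧ ‖A b.1 b.2‖ ≤ cstar * ((L : ℝ) ^ j * η)⁻¹ := by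
  have hL1 : 1 ≤ L := le_trans (by norm_num) hL
  have hcstar : 0 ≤ cstar := by rw [hc]; positivity
  have hα₂ : 0 ≤ 2 * (L * cstar) + 8 * α₄ := by positivity
  have hE : ∀ j, {b : Site d × Fin d | SideTouches (Ω (j + 1)) b.1 b.2} ⊆ {b : Site d × Fin d | SideTouches (Ω j) b.1 b.2} :=
    fun j b hb => B8Eq140Level.sideTouches_mono (hΩ j) hb
  exact thm4_exists_all_levels_supp_bdry hL1 hη (Ω 0) hU₀ hU' hcstar hα₄ hs₁ hs₂ ha ha2
    (fun j => {b : Site d × Fin d | SideTouches (Ω j) b.1 b.2}) hE h66 Λs (fun m W => IsLandau138W L m η (Ω 0) (Λs m) U₀ W)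
    hP5base hP5
    (hP3_gaugeFixed_of_b9_bdry hd2 hη hL k hU₀ hU' hα₀ hα₁.le hα₄ hB₀ hc hα3 hα4 h16 hd5 hsmall hc₃ hside h50 hC₂ h61 hBbd ha0 ha
      hbdry Ω Λs Λb hbox h33 h34 h66 (fun m W => IsLandau138W L m η (Ω 0) (Λs m) U₀ W)
      (B8Eq142KLevelLocal.H42_of_inAx hd2 hη hL k hU₀ hα₀ hα₁ hα₂ hα3 hα4 h16 hsmall hc₃ hsmall₁ Ω hΩ Λs Λb hbox hclass h33 h34
        hAx h135 (fun m W => IsLandau138W L m η (Ω 0) (Λs m) U₀ W))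
      H59D)


#print axioms thm4_exists_all_levels_supp_landau138_bdry

end Composition

end Literature.MathematicalPhysics.QuantumFieldTheory.Balaban1983to89.B8Thm4SupportLocalBdry

end
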